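import Summits.ValiantsHypothesis.ValiantsHypothesis.Theorems.BarrierLeverPartitionMinorsHitByVPBrickCalculus

/-!
# Route BarrierLever — item `PartitionMinorsHitByVP` (stmt-ValiantsHypothesis-19717):
# CUBE versus HAMMING BALL, part 1/2 — the witness, its row rules and its size

Helper file (`--supports stmt-ValiantsHypothesis-19717`; cell valiant-natproofs, rung V4, 𝒟-side door (c);
prover seat val-np-p1 gen 14). Closes NO item.

**The stress pair.** The cell's recognised hard layout family for item 19717 is the CUBE versus the HAMMING BALL:
rows = all `4^k` subsets of the `2k` `x`-vertices `{0,…,2k−1}`, columns = all `4^k` subsets of size `≤ k` of the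
`2k+1` `y`-vertices (`h = 2k+1`); why it is hard: seat memo HOME/val-np-p1/g14/ANCHORED-MEMO-valnp1-g14.md §§1, 3.4.
Part 2 (`…CubeBall`) proves that the weight-one brick product
```
  F_k = ∏_{j<k} B_j,   B_j = (1 + x_{2j} y_{2j}) (1 + x_{2j+1} y_{2j+1}) ∏_{d ∈ Y_j} (1 + x_{2j} x_{2j+1} y_d),
  Y_j = {y_{2k}} ∪ {y_d : d < 2j}      (k(k+2) bricks; inside `SmallCircuits ℂ (h+h) 8`)
```
hits the pair AT EVERY `k`, by induction on `j` with HARD LEFSCHETZ for the Boolean lattice `B_{2j+1}`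
(`Literature.Combinatorics.Posets.BooleanOrderRaising`) as the only external input.

**This file:** the witness `witness k j = F_j` (`j ≤ k`, ambient `h = 2k+1`, vertices `vtx k i = i`), its variable
support (`coeff_witness_eq_zero_of_not_subset`), its size (`complexity_witness_le`), and THE FOUR ROW RULES of `F_{j+1}`
in terms of `F_j` (`coeff_witness_succ_none/left/right/both`): with `a = x_{2j}`, `b = x_{2j+1}`, `a' = y_{2j}`,
`b' = y_{2j+1}`, `S ⊆ X_j = {x_0,…,x_{2j−1}}`: `F_{j+1}[S,T] = F_j[S,T]`, `F_{j+1}[S+a,T] = [a'∈T] F_j[S,T−a']`,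
`F_{j+1}[S+b,T] = [b'∈T] F_j[S,T−b']`, `F_{j+1}[S+a+b,T] = [a',b'∈T] F_j[S,T−a'−b'] + Σ_{d ∈ T ∩ Y_j} F_j[S, T−d]`
(zeon rows `ρ'`, `y_{a'}ρ'`, `y_{b'}ρ'`, `(y_{a'}y_{b'} + q_j)ρ'`, `q_j = Σ_{d∈Y_j} y_d` the Lefschetz element).

WHAT THIS IS NOT: item 19717 is not closed by one layout family; nothing on crux stmt-ValiantsHypothesis-14610 or
`VP` versus `VNP`.
-/

set_option linter.dupNamespace false

namespace Summit.ValiantsHypothesis.ValiantsHypothesis.Theorems.BarrierLever.CubeBall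

open Finset MvPolynomial
open Literature.Computability.AlgebraicComplexity
open Summit.ValiantsHypothesis.ValiantsHypothesis.Theorems.BarrierLever.BrickCalculus

noncomputable section

/-! ## 3. The cube-versus-ball witness -/

/-- Vertex number `i` of `Fin (2k+1)` (junk value `2k` for `i > 2k`). -/
def vtx (k i : ℕ) : Fin (2 * k + 1) := ⟨min i (2 * k), by omega⟩

/-- `vtx` is injective on `[0, 2k]`. -/
theorem vtx_inj {k i i' : ℕ} (hi : i ≤ 2 * k) (hi' : i' ≤ 2 * k) (hv : vtx k i = vtx k i') : i = i' := by
  have := congrArg Fin.val hv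
  simp only [vtx] at this
  omega

/-- The `x`-vertices `{0,…,2j−1}` of the `j`-th cube. -/
def xSet (k j : ℕ) : Finset (Fin (2 * k + 1)) := (Finset.range (2 * j)).image (vtx k)

/-- The `y`-vertices `{2k} ∪ {0,…,2j−1}` of the `j`-th ball (`2j+1` of them). -/
def ySet (k j : ℕ) : Finset (Fin (2 * k + 1)) := insert (vtx k (2 * k)) ((Finset.range (2 * j)).image (vtx k))

/-- The `j`-th block `B_j = (1 + x_{2j}y_{2j})(1 + x_{2j+1}y_{2j+1}) ∏_{d ∈ Y_j} (1 + x_{2j}x_{2j+1}y_d)`. -/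
def blockW (k j : ℕ) : MvPolynomial (Fin ((2 * k + 1) + (2 * k + 1))) ℂ :=
  brick {vtx k (2 * j)} {vtx k (2 * j)} * brick {vtx k (2 * j + 1)} {vtx k (2 * j + 1)} *
    ∏ d ∈ ySet k j, brick {vtx k (2 * j), vtx k (2 * j + 1)} {d}

/-- **The cube-versus-ball witness** `F_j = ∏_{j' < j} B_{j'}` (a weight-one brick product with `j(j+2)` bricks). -/
def witness (k : ℕ) : ℕ → MvPolynomial (Fin ((2 * k + 1) + (2 * k + 1))) ℂ
  | 0 => 1
  | j + 1 => witness k j * blockW k j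

/-- Unfolding the successor step. -/
theorem witness_succ (k j : ℕ) : witness k (j + 1) = witness k j * blockW k j := rfl

section facts
variable {k j : ℕ}
/-- The two vertices of the `j`-th pair are distinct. -/
theorem vtx_two_mul_ne (hj : j < k) : vtx k (2 * j) ≠ vtx k (2 * j + 1) := fun hv =>
  absurd (vtx_inj (by omega) (by omega) hv) (by omega)
/-- Vertices `≥ 2j` (and `≤ 2k`) are not in `X_j`. -/
theorem vtx_not_mem_xSet {i : ℕ} (hi : 2 * j ≤ i) (hik : i ≤ 2 * k) : vtx k i ∉ xSet k j := by
  intro hm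
  obtain ⟨i', hi', hv⟩ := Finset.mem_image.mp hm
  have := vtx_inj (by have := Finset.mem_range.mp hi'; omega) hik hv
  have := Finset.mem_range.mp hi'; omega
/-- Vertices in `[2j, 2k)` are not in `Y_j`. -/
theorem vtx_not_mem_ySet {i : ℕ} (hi : 2 * j ≤ i) (hik : i < 2 * k) : vtx k i ∉ ySet k j := fun hm => by
  rcases Finset.mem_insert.mp hm with hv | hm'
  · exact absurd (vtx_inj (by omega) (by omega) hv) (by omega)
  · exact vtx_not_mem_xSet hi hik.le hm'
/-- `x_{2j} ∉ X_j`. -/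
theorem vtx_even_not_mem_xSet (hj : j < k) : vtx k (2 * j) ∉ xSet k j := vtx_not_mem_xSet le_rfl (by omega)
/-- `x_{2j+1} ∉ X_j`. -/
theorem vtx_odd_not_mem_xSet (hj : j < k) : vtx k (2 * j + 1) ∉ xSet k j := vtx_not_mem_xSet (by omega) (by omega)
/-- `y_{2j} ∉ Y_j`. -/
theorem vtx_even_not_mem_ySet (hj : j < k) : vtx k (2 * j) ∉ ySet k j := vtx_not_mem_ySet le_rfl (by omega)
/-- `y_{2j+1} ∉ Y_j`. -/
theorem vtx_odd_not_mem_ySet (hj : j < k) : vtx k (2 * j + 1) ∉ ySet k j := vtx_not_mem_ySet (by omega) (by omega)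
/-- `X_{j+1} = X_j ∪ {2j, 2j+1}`. -/
theorem xSet_succ (k j : ℕ) : xSet k (j + 1) = insert (vtx k (2 * j)) (insert (vtx k (2 * j + 1)) (xSet k j)) := by
  ext v
  simp only [xSet, Finset.mem_image, Finset.mem_range, Finset.mem_insert]
  constructor
  · rintro ⟨i, hi, rfl⟩
    by_cases h1 : i = 2 * j
    · exact Or.inl (by rw [h1])
    by_cases h2 : i = 2 * j + 1
    · exact Or.inr (Or.inl (by rw [h2]))
    · exact Or.inr (Or.inr ⟨i, by omega, rfl⟩)
  · rintro (rfl | rfl | ⟨i, hi, rfl⟩)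
    · exact ⟨2 * j, by omega, rfl⟩
    · exact ⟨2 * j + 1, by omega, rfl⟩
    · exact ⟨i, by omega, rfl⟩
/-- `Y_{j+1} = Y_j ∪ {2j, 2j+1}`. -/
theorem ySet_succ (k j : ℕ) : ySet k (j + 1) = insert (vtx k (2 * j)) (insert (vtx k (2 * j + 1)) (ySet k j)) := by
  rw [ySet, ySet, ← xSet, ← xSet, xSet_succ]
  ext v; simp only [Finset.mem_insert]; tauto
/-- `X_j ⊆ X_{j+1}`. -/
theorem xSet_subset_succ (k j : ℕ) : xSet k j ⊆ xSet k (j + 1) := by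
  rw [xSet_succ]; exact (Finset.subset_insert _ _).trans (Finset.subset_insert _ _)
/-- `Y_j ⊆ Y_{j+1}`. -/
theorem ySet_subset_succ (k j : ℕ) : ySet k j ⊆ ySet k (j + 1) := by
  rw [ySet_succ]; exact (Finset.subset_insert _ _).trans (Finset.subset_insert _ _)
end facts

/-- Variables after multiplying by a fan of bricks `∏_{d ∈ D} (1 + x^Z y_d)`. -/
theorem vars_mul_prod_brick_subset {h : ℕ} (f : MvPolynomial (Fin (h + h)) ℂ) (A B Z D : Finset (Fin h))
    (hf : f.vars ⊆ A.image (Fin.castAdd h) ∪ B.image (Fin.natAdd h)) (hZ : Z ⊆ A) (hD : D ⊆ B) :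
    (f * ∏ d ∈ D, brick Z {d}).vars ⊆ A.image (Fin.castAdd h) ∪ B.image (Fin.natAdd h) := by
  classical
  induction D using Finset.induction_on with
  | empty => rw [Finset.prod_empty, mul_one]; exact hf
  | insert d₀ D hd₀ ih =>
    rw [Finset.prod_insert hd₀, ← mul_assoc, mul_right_comm]
    exact vars_mul_brick_subset _ _ _ _ _ (ih ((Finset.subset_insert _ _).trans hD)) hZ
      (Finset.singleton_subset_iff.mpr (hD (Finset.mem_insert_self _ _)))

/-- The variables of `F_j` are `x_a`, `a ∈ X_j`, and `y_c`, `c ∈ Y_j`. -/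
theorem vars_witness_subset (k j : ℕ) (hj : j ≤ k) :
    (witness k j).vars ⊆ (xSet k j).image (Fin.castAdd (2 * k + 1)) ∪ (ySet k j).image (Fin.natAdd (2 * k + 1)) := by
  classical
  induction j with
  | zero => rw [witness, vars_one]; exact Finset.empty_subset _
  | succ j ih =>
    have ih' : (witness k j).vars ⊆ (xSet k (j + 1)).image (Fin.castAdd (2 * k + 1)) ∪
        (ySet k (j + 1)).image (Fin.natAdd (2 * k + 1)) :=
      (ih (Nat.le_of_succ_le hj)).trans (Finset.union_subset_union
        (Finset.image_subset_image (xSet_subset_succ k j)) (Finset.image_subset_image (ySet_subset_succ k j)))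
    have ha : vtx k (2 * j) ∈ xSet k (j + 1) := by rw [xSet_succ]; exact Finset.mem_insert_self _ _
    have hb : vtx k (2 * j + 1) ∈ xSet k (j + 1) := by
      rw [xSet_succ]; exact Finset.mem_insert_of_mem (Finset.mem_insert_self _ _)
    have ha' : vtx k (2 * j) ∈ ySet k (j + 1) := by rw [ySet_succ]; exact Finset.mem_insert_self _ _
    have hb' : vtx k (2 * j + 1) ∈ ySet k (j + 1) := by
      rw [ySet_succ]; exact Finset.mem_insert_of_mem (Finset.mem_insert_self _ _)
    rw [witness_succ, blockW, ← mul_assoc, ← mul_assoc]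
    refine vars_mul_prod_brick_subset _ _ _ _ _ ?_ ?_ (ySet_subset_succ k j)
    · exact vars_mul_brick_subset _ _ _ _ _ (vars_mul_brick_subset _ _ _ _ _ ih'
        (Finset.singleton_subset_iff.mpr ha) (Finset.singleton_subset_iff.mpr ha'))
        (Finset.singleton_subset_iff.mpr hb) (Finset.singleton_subset_iff.mpr hb')
    · intro v hv
      rcases Finset.mem_insert.mp hv with rfl | hv'
      · exact ha
      · rw [Finset.mem_singleton.mp hv']; exact hb

/-- Rows of `F_j` vanish off `X_j × Y_j`. -/
theorem coeff_witness_eq_zero_of_not_subset {k j : ℕ} (hj : j ≤ k) (U W : Finset (Fin (2 * k + 1)))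
    (hUW : ¬ (U ⊆ xSet k j ∧ W ⊆ ySet k j)) : coeff (pexpo U W) (witness k j) = 0 :=
  coeff_pexpo_eq_zero_of_vars _ _ _ (vars_witness_subset k j hj) U W hUW

/-- `F_{j+1}` in terms of the intermediate product (the fan `∏_{d ∈ Y_j} (1 + x_a x_b y_d)`). -/
private theorem row_succ (k j : ℕ) (U W : Finset (Fin (2 * k + 1))) :
    coeff (pexpo U W) (witness k (j + 1)) =
      coeff (pexpo U W) (witness k j * brick {vtx k (2 * j)} {vtx k (2 * j)} *
        brick {vtx k (2 * j + 1)} {vtx k (2 * j + 1)}) +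
      if {vtx k (2 * j), vtx k (2 * j + 1)} ⊆ U then ∑ d ∈ (ySet k j).filter (· ∈ W),
        coeff (pexpo (U \ {vtx k (2 * j), vtx k (2 * j + 1)}) (W.erase d))
          (witness k j * brick {vtx k (2 * j)} {vtx k (2 * j)} * brick {vtx k (2 * j + 1)} {vtx k (2 * j + 1)})
        else 0 := by
  rw [witness_succ, blockW, ← mul_assoc, ← mul_assoc,
    coeff_pexpo_mul_prod_brick _ _ ⟨_, Finset.mem_insert_self _ _⟩]

/-- A pair is not contained in a set missing one of its elements. -/
private theorem pair_not_subset_of_not_mem {k : ℕ} {a b : Fin (2 * k + 1)} {U : Finset (Fin (2 * k + 1))}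
    (h' : a ∉ U ∨ b ∉ U) : ¬ ({a, b} ⊆ U) := fun hsub => by
  rcases h' with h' | h'
  · exact h' (hsub (Finset.mem_insert_self _ _))
  · exact h' (hsub (Finset.mem_insert_of_mem (Finset.mem_singleton_self _)))

section rows
variable {k j : ℕ} (hj : j < k) (S : Finset (Fin (2 * k + 1))) (hS : S ⊆ xSet k j) (T : Finset (Fin (2 * k + 1)))
include hj hS

/-- Rows `S ⊆ X_j` of the intermediate product `F_j (1 + x_a y_a)(1 + x_b y_b)` are rows of `F_j`. -/
private theorem row_mid_none (W : Finset (Fin (2 * k + 1))) :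
    coeff (pexpo S W) (witness k j * brick {vtx k (2 * j)} {vtx k (2 * j)} *
      brick {vtx k (2 * j + 1)} {vtx k (2 * j + 1)}) = coeff (pexpo S W) (witness k j) := by
  have ha : vtx k (2 * j) ∉ S := fun hm => vtx_even_not_mem_xSet hj (hS hm)
  have hb : vtx k (2 * j + 1) ∉ S := fun hm => vtx_odd_not_mem_xSet hj (hS hm)
  rw [coeff_pexpo_mul_brick, if_neg (fun hc => hb (Finset.singleton_subset_iff.mp hc.1)), add_zero,
    coeff_pexpo_mul_brick, if_neg (fun hc => ha (Finset.singleton_subset_iff.mp hc.1)), add_zero]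

/-- Rows `S + a` of `F_j (1 + x_a y_a)`. -/
private theorem row_one_left (W : Finset (Fin (2 * k + 1))) :
    coeff (pexpo (insert (vtx k (2 * j)) S) W) (witness k j * brick {vtx k (2 * j)} {vtx k (2 * j)}) =
      if vtx k (2 * j) ∈ W then coeff (pexpo S (W.erase (vtx k (2 * j)))) (witness k j) else 0 := by
  have ha : vtx k (2 * j) ∉ S := fun hm => vtx_even_not_mem_xSet hj (hS hm)
  have hzero : coeff (pexpo (insert (vtx k (2 * j)) S) W) (witness k j) = 0 :=
    coeff_witness_eq_zero_of_not_subset hj.le _ _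
      (fun hc => vtx_even_not_mem_xSet hj (hc.1 (Finset.mem_insert_self _ _)))
  rw [coeff_pexpo_mul_brick, hzero, zero_add]
  by_cases haW : vtx k (2 * j) ∈ W
  · rw [if_pos ⟨Finset.singleton_subset_iff.mpr (Finset.mem_insert_self _ _), Finset.singleton_subset_iff.mpr haW⟩,
      if_pos haW, Finset.sdiff_singleton_eq_erase, Finset.sdiff_singleton_eq_erase, Finset.erase_insert ha]
  · rw [if_neg (fun hc => haW (Finset.singleton_subset_iff.mp hc.2)), if_neg haW]

/-- Rows `S + a` of the intermediate product. -/
private theorem row_mid_left (W : Finset (Fin (2 * k + 1))) :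
    coeff (pexpo (insert (vtx k (2 * j)) S) W) (witness k j * brick {vtx k (2 * j)} {vtx k (2 * j)} *
      brick {vtx k (2 * j + 1)} {vtx k (2 * j + 1)}) =
      if vtx k (2 * j) ∈ W then coeff (pexpo S (W.erase (vtx k (2 * j)))) (witness k j) else 0 := by
  have hb : vtx k (2 * j + 1) ∉ S := fun hm => vtx_odd_not_mem_xSet hj (hS hm)
  have hab := vtx_two_mul_ne hj
  have hb' : vtx k (2 * j + 1) ∉ insert (vtx k (2 * j)) S := fun hm => by
    rcases Finset.mem_insert.mp hm with hv | hv
    · exact hab hv.symm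
    · exact hb hv
  rw [coeff_pexpo_mul_brick, if_neg (fun hc => hb' (Finset.singleton_subset_iff.mp hc.1)), add_zero,
    row_one_left hj S hS]

/-- Rows `S + b` of the intermediate product. -/
private theorem row_mid_right (W : Finset (Fin (2 * k + 1))) :
    coeff (pexpo (insert (vtx k (2 * j + 1)) S) W) (witness k j * brick {vtx k (2 * j)} {vtx k (2 * j)} *
      brick {vtx k (2 * j + 1)} {vtx k (2 * j + 1)}) =
      if vtx k (2 * j + 1) ∈ W then coeff (pexpo S (W.erase (vtx k (2 * j + 1)))) (witness k j) else 0 := by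
  have ha : vtx k (2 * j) ∉ S := fun hm => vtx_even_not_mem_xSet hj (hS hm)
  have hb : vtx k (2 * j + 1) ∉ S := fun hm => vtx_odd_not_mem_xSet hj (hS hm)
  have hab := vtx_two_mul_ne hj
  have ha' : vtx k (2 * j) ∉ insert (vtx k (2 * j + 1)) S := fun hm => by
    rcases Finset.mem_insert.mp hm with hv | hv
    · exact hab hv
    · exact ha hv
  have hzero : coeff (pexpo (insert (vtx k (2 * j + 1)) S) W) (witness k j) = 0 :=
    coeff_witness_eq_zero_of_not_subset hj.le _ _
      (fun hc => vtx_odd_not_mem_xSet hj (hc.1 (Finset.mem_insert_self _ _)))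
  have hfirst : coeff (pexpo (insert (vtx k (2 * j + 1)) S) W)
      (witness k j * brick {vtx k (2 * j)} {vtx k (2 * j)}) = 0 := by
    rw [coeff_pexpo_mul_brick, hzero, zero_add, if_neg (fun hc => ha' (Finset.singleton_subset_iff.mp hc.1))]
  rw [coeff_pexpo_mul_brick, hfirst, zero_add]
  by_cases hbW : vtx k (2 * j + 1) ∈ W
  · rw [if_pos ⟨Finset.singleton_subset_iff.mpr (Finset.mem_insert_self _ _), Finset.singleton_subset_iff.mpr hbW⟩,
      if_pos hbW, Finset.sdiff_singleton_eq_erase, Finset.sdiff_singleton_eq_erase, Finset.erase_insert hb,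
      coeff_pexpo_mul_brick, if_neg (fun hc => ha (Finset.singleton_subset_iff.mp hc.1)), add_zero]
  · rw [if_neg (fun hc => hbW (Finset.singleton_subset_iff.mp hc.2)), if_neg hbW]

/-- Rows `S + a + b` of the intermediate product. -/
private theorem row_mid_both (W : Finset (Fin (2 * k + 1))) :
    coeff (pexpo (insert (vtx k (2 * j)) (insert (vtx k (2 * j + 1)) S)) W)
      (witness k j * brick {vtx k (2 * j)} {vtx k (2 * j)} * brick {vtx k (2 * j + 1)} {vtx k (2 * j + 1)}) =
      if vtx k (2 * j) ∈ W ∧ vtx k (2 * j + 1) ∈ W then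
        coeff (pexpo S ((W.erase (vtx k (2 * j + 1))).erase (vtx k (2 * j)))) (witness k j) else 0 := by
  have ha : vtx k (2 * j) ∉ S := fun hm => vtx_even_not_mem_xSet hj (hS hm)
  have hb : vtx k (2 * j + 1) ∉ S := fun hm => vtx_odd_not_mem_xSet hj (hS hm)
  have hab := vtx_two_mul_ne hj
  have ha' : vtx k (2 * j) ∉ insert (vtx k (2 * j + 1)) S := fun hm => by
    rcases Finset.mem_insert.mp hm with hv | hv
    · exact hab hv
    · exact ha hv
  -- the first summand `coeff_{S+a+b, W} (F_j (1 + x_a y_a))` vanishes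
  have hfirst : coeff (pexpo (insert (vtx k (2 * j)) (insert (vtx k (2 * j + 1)) S)) W)
      (witness k j * brick {vtx k (2 * j)} {vtx k (2 * j)}) = 0 := by
    rw [coeff_pexpo_mul_brick, coeff_witness_eq_zero_of_not_subset hj.le _ _
      (fun hc => vtx_even_not_mem_xSet hj (hc.1 (Finset.mem_insert_self _ _))), zero_add]
    by_cases hc : {vtx k (2 * j)} ⊆ insert (vtx k (2 * j)) (insert (vtx k (2 * j + 1)) S) ∧ {vtx k (2 * j)} ⊆ W
    · rw [if_pos hc, Finset.sdiff_singleton_eq_erase, Finset.erase_insert ha']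
      exact coeff_witness_eq_zero_of_not_subset hj.le _ _
        (fun hc' => vtx_odd_not_mem_xSet hj (hc'.1 (Finset.mem_insert_self _ _)))
    · rw [if_neg hc]
  rw [coeff_pexpo_mul_brick, hfirst, zero_add]
  by_cases hbW : vtx k (2 * j + 1) ∈ W
  · rw [if_pos ⟨Finset.singleton_subset_iff.mpr (Finset.mem_insert_of_mem (Finset.mem_insert_self _ _)),
      Finset.singleton_subset_iff.mpr hbW⟩, Finset.sdiff_singleton_eq_erase, Finset.sdiff_singleton_eq_erase,
      Finset.erase_insert_of_ne hab, Finset.erase_insert hb, row_one_left hj S hS]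
    by_cases haW : vtx k (2 * j) ∈ W
    · rw [if_pos (Finset.mem_erase.mpr ⟨hab, haW⟩), if_pos ⟨haW, hbW⟩]
    · rw [if_neg (fun hm => haW (Finset.mem_erase.mp hm).2), if_neg (fun hc => haW hc.1)]
  · rw [if_neg (fun hc => hbW (Finset.singleton_subset_iff.mp hc.2)), if_neg (fun hc => hbW hc.2)]

/-- **Row rule (none).** For `S ⊆ X_j`: `F_{j+1}[S, T] = F_j[S, T]`. -/
theorem coeff_witness_succ_none : coeff (pexpo S T) (witness k (j + 1)) = coeff (pexpo S T) (witness k j) := by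
  have ha : vtx k (2 * j) ∉ S := fun hm => vtx_even_not_mem_xSet hj (hS hm)
  rw [row_succ k j, if_neg (pair_not_subset_of_not_mem (Or.inl ha)), add_zero, row_mid_none hj S hS]

/-- **Row rule (left).** For `S ⊆ X_j`: `F_{j+1}[S + x_{2j}, T] = [y_{2j} ∈ T] · F_j[S, T ∖ y_{2j}]`. -/
theorem coeff_witness_succ_left : coeff (pexpo (insert (vtx k (2 * j)) S) T) (witness k (j + 1)) =
    if vtx k (2 * j) ∈ T then coeff (pexpo S (T.erase (vtx k (2 * j)))) (witness k j) else 0 := by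
  have hb : vtx k (2 * j + 1) ∉ S := fun hm => vtx_odd_not_mem_xSet hj (hS hm)
  have hab := vtx_two_mul_ne hj
  have hb' : vtx k (2 * j + 1) ∉ insert (vtx k (2 * j)) S := fun hm => by
    rcases Finset.mem_insert.mp hm with hv | hv
    · exact hab hv.symm
    · exact hb hv
  rw [row_succ k j, if_neg (pair_not_subset_of_not_mem (Or.inr hb')), add_zero, row_mid_left hj S hS]

/-- **Row rule (right).** For `S ⊆ X_j`: `F_{j+1}[S + x_{2j+1}, T] = [y_{2j+1} ∈ T] · F_j[S, T ∖ y_{2j+1}]`. -/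
theorem coeff_witness_succ_right : coeff (pexpo (insert (vtx k (2 * j + 1)) S) T) (witness k (j + 1)) =
    if vtx k (2 * j + 1) ∈ T then coeff (pexpo S (T.erase (vtx k (2 * j + 1)))) (witness k j) else 0 := by
  have ha : vtx k (2 * j) ∉ S := fun hm => vtx_even_not_mem_xSet hj (hS hm)
  have hab := vtx_two_mul_ne hj
  have ha' : vtx k (2 * j) ∉ insert (vtx k (2 * j + 1)) S := fun hm => by
    rcases Finset.mem_insert.mp hm with hv | hv
    · exact hab hv
    · exact ha hv
  rw [row_succ k j, if_neg (pair_not_subset_of_not_mem (Or.inl ha')), add_zero, row_mid_right hj S hS]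

/-- **Row rule (both).** For `S ⊆ X_j`:
`F_{j+1}[S + x_{2j} + x_{2j+1}, T] = [y_{2j}, y_{2j+1} ∈ T] · F_j[S, T ∖ y_{2j+1} ∖ y_{2j}] + Σ_{d ∈ Y_j ∩ T} F_j[S, T ∖ d]`. -/
theorem coeff_witness_succ_both :
    coeff (pexpo (insert (vtx k (2 * j)) (insert (vtx k (2 * j + 1)) S)) T) (witness k (j + 1)) =
      (if vtx k (2 * j) ∈ T ∧ vtx k (2 * j + 1) ∈ T then
        coeff (pexpo S ((T.erase (vtx k (2 * j + 1))).erase (vtx k (2 * j)))) (witness k j) else 0) +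
      ∑ d ∈ (ySet k j).filter (· ∈ T), coeff (pexpo S (T.erase d)) (witness k j) := by
  have ha : vtx k (2 * j) ∉ S := fun hm => vtx_even_not_mem_xSet hj (hS hm)
  have hb : vtx k (2 * j + 1) ∉ S := fun hm => vtx_odd_not_mem_xSet hj (hS hm)
  have hsd : insert (vtx k (2 * j)) (insert (vtx k (2 * j + 1)) S) \ {vtx k (2 * j), vtx k (2 * j + 1)} = S := by
    ext v
    simp only [Finset.mem_sdiff, Finset.mem_insert, Finset.mem_singleton]
    constructor
    · rintro ⟨h1 | h1 | h1, h2⟩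
      · exact absurd (Or.inl h1) h2
      · exact absurd (Or.inr h1) h2
      · exact h1
    · intro hv
      refine ⟨Or.inr (Or.inr hv), ?_⟩
      rintro (rfl | rfl)
      · exact ha hv
      · exact hb hv
  rw [row_succ k j, row_mid_both hj S hS, if_pos (Finset.insert_subset_insert _ (Finset.singleton_subset_iff.mpr
    (Finset.mem_insert_self _ _))), hsd]
  congr 1
  exact Finset.sum_congr rfl (fun d _ => row_mid_none hj S hS _)

end rows


/-! ## 4. Size of the witness, and the top cube -/

/-- Size of one block: `L(B_j) ≤ (h+2)(2h+4)` with `h = 2k+1`. -/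
theorem complexity_blockW_le (k j : ℕ) :
    complexity (blockW k j) ≤ ((2 * k + 1) + 2) * (2 * (2 * k + 1) + 4) := by
  have hb : ∀ Z W : Finset (Fin (2 * k + 1)), complexity (brick Z W) ≤ 2 * (2 * k + 1) + 3 :=
    fun Z W => complexity_brick_le' Z W
  have hY : (ySet k j).card ≤ 2 * k + 1 := (Finset.card_le_univ _).trans_eq (Fintype.card_fin _)
  rw [blockW]
  calc _ ≤ complexity (brick {vtx k (2 * j)} {vtx k (2 * j)} * brick {vtx k (2 * j + 1)} {vtx k (2 * j + 1)}) +
        complexity (∏ d ∈ ySet k j, brick {vtx k (2 * j), vtx k (2 * j + 1)} {d}) + 1 :=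
        complexity_mul_le_holds _ _
    _ ≤ ((2 * (2 * k + 1) + 3) + (2 * (2 * k + 1) + 3) + 1) +
        (∑ _d ∈ ySet k j, (2 * (2 * k + 1) + 3) + (ySet k j).card) + 1 := by
        gcongr
        · exact (complexity_mul_le_holds _ _).trans (by gcongr <;> exact hb _ _)
        · exact (complexity_finset_prod_le _ _).trans (by gcongr with d _; exact hb _ _)
    _ = (2 * (2 * k + 1) + 3) * ((ySet k j).card + 2) + (ySet k j).card + 2 := by
        rw [Finset.sum_const, smul_eq_mul]; ring
    _ ≤ (2 * (2 * k + 1) + 3) * ((2 * k + 1) + 2) + (2 * k + 1) + 2 := by gcongr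
    _ = ((2 * k + 1) + 2) * (2 * (2 * k + 1) + 4) := by ring

/-- Size of the witness: `L(F_j) ≤ j · ((h+2)(2h+4) + 1)`. -/
theorem complexity_witness_le (k : ℕ) : ∀ j,
    complexity (witness k j) ≤ j * (((2 * k + 1) + 2) * (2 * (2 * k + 1) + 4) + 1)
  | 0 => by rw [witness, ← C_1, complexity_C_holds]; exact Nat.zero_le _
  | j + 1 => by
    rw [witness_succ]
    calc _ ≤ complexity (witness k j) + complexity (blockW k j) + 1 := complexity_mul_le_holds _ _
      _ ≤ j * (((2 * k + 1) + 2) * (2 * (2 * k + 1) + 4) + 1) +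
          ((2 * k + 1) + 2) * (2 * (2 * k + 1) + 4) + 1 := by
          gcongr
          · exact complexity_witness_le k j
          · exact complexity_blockW_le k j
      _ = (j + 1) * (((2 * k + 1) + 2) * (2 * (2 * k + 1) + 4) + 1) := by ring

/-- `X_k` is everything but the last `x`-vertex `2k`. -/
theorem subset_xSet_self_iff (k : ℕ) (S : Finset (Fin (2 * k + 1))) : S ⊆ xSet k k ↔ vtx k (2 * k) ∉ S := by
  constructor
  · intro hS hm
    obtain ⟨i, hi, hv⟩ := Finset.mem_image.mp (hS hm)
    have := vtx_inj (by have := Finset.mem_range.mp hi; omega) (by omega) hv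
    have := Finset.mem_range.mp hi; omega
  · intro hS v hv
    refine Finset.mem_image.mpr ⟨v.val, Finset.mem_range.mpr ?_, ?_⟩
    · have h1 : v.val ≤ 2 * k := by have := v.isLt; omega
      rcases Nat.lt_or_eq_of_le h1 with h2 | h2
      · exact h2
      · exfalso; apply hS
        have : vtx k (2 * k) = v := Fin.ext (by simp [vtx, h2])
        rwa [this]
    · exact Fin.ext (by have := v.isLt; simp [vtx]; omega)


end

end Summit.ValiantsHypothesis.ValiantsHypothesis.Theorems.BarrierLever.CubeBall
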